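import Mathlib
import Literature.NumberTheory.GaloisRepresentations.FrobeniusDensity
import Literature.NumberTheory.Automorphic.ChebotarevArtinRepHolds
import Literature.NumberTheory.GaloisRepresentations.GaloisRep
import HarnessLib

/-!
# Stub `stub_frobeniusSignTransfer` (S3) of the line `SketchIdeator2` for the crux
# `ParityBlindBianchi.ArtinWeightRealisationEven` (item stmt-Langlands-16619)

Chebotarev transfer: for two framed `p`-adic Galois representations `σ r : Γ_K → GL₂(ℚ̄_p)` of a
number field `K` whose Frobenius characteristic polynomials at every good place `v` (a place above
no `ℓ ∈ S₀`, `0 ∉ S₀`) agree up to the flip `X ↦ -X`, one has `det r(g) = det σ(g)` and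
`tr r(g) = ± tr σ(g)` for **every** `g ∈ Γ_K`.  Proof: the condition set is closed (continuity of
`g ↦ r g, σ g` as matrices, of `det` and `trace`; `ℚ̄_p` is Hausdorff) and contains the arithmetic
Frobenii at the good places (a `2 × 2` characteristic polynomial `X² - tr·X + det` determines
`det` and `tr`, and its flip `X² + tr·X + det` determines `det` and `-tr`), which are dense in
`Γ_K` by Chebotarev (`absoluteGaloisGroup.frobenius_dense` fed with `chebotarev_artinRep_holds`),
the bad set `{v | ∃ ℓ ∈ S₀, ℓ ∈ v}` being finite (`Ideal.finite_factors`, as `0 ∉ S₀`).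
-/

-- the line's namespace `Summit.Langlands.Langlands.…` (summit = problem = `Langlands`) repeats a component by design
set_option linter.dupNamespace false

namespace Summit.Langlands.Langlands.Theorems.ArtinWeightRealisationEven

open scoped MatrixGroups Matrix Polynomial NumberField
open NumberField IsDedekindDomain Polynomial Field
open Literature.NumberTheory.Automorphic Literature.NumberTheory.GaloisRepresentations

/-- For `2 × 2` matrices `M`, `N` over a nontrivial commutative ring: if the characteristic
polynomial of `N` is that of `M` or its flip `P(-X)`, then `det M = det N` and `tr M = ± tr N`
(compare the coefficients of `X² - tr·X + det`, Mathlib `Matrix.charpoly_fin_two`). -/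
theorem det_trace_of_charpoly_eq_or_comp_neg_X {R : Type*} [CommRing R] [Nontrivial R]
    {M N : Matrix (Fin 2) (Fin 2) R} {P : R[X]}
    (hM : M.charpoly = P) (hN : N.charpoly = P ∨ N.charpoly = P.comp (-X)) :
    M.det = N.det ∧ (M.trace = N.trace ∨ M.trace = -N.trace) := by
  subst hM
  rw [Matrix.charpoly_fin_two, Matrix.charpoly_fin_two] at hN
  rcases hN with h | h
  · have h0 := congrArg (fun q : R[X] => q.coeff 0) h
    have h1 := congrArg (fun q : R[X] => q.coeff 1) h
    simp at h0 h1
    exact ⟨h0.symm, Or.inl h1.symm⟩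
  · have h0 := congrArg (fun q : R[X] => q.coeff 0) h
    have h1 := congrArg (fun q : R[X] => q.coeff 1) h
    simp at h0 h1
    exact ⟨h0.symm, Or.inr (by linear_combination -h1)⟩

/-- For a number field `K` and a finite set `S₀` of natural numbers not containing `0`, the set
of finite places `v` of `K` lying above some `ℓ ∈ S₀` is finite (each nonzero `(ℓ) ⊂ 𝓞 K` has
finitely many prime factors, Mathlib `Ideal.finite_factors`). -/
theorem finite_setOf_exists_natCast_mem_asIdeal (K : Type*) [Field K] [NumberField K]
    (S₀ : Finset ℕ) (h0 : (0 : ℕ) ∉ S₀) :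
    {v : HeightOneSpectrum (𝓞 K) | ∃ ℓ ∈ S₀, ((ℓ : ℕ) : 𝓞 K) ∈ v.asIdeal}.Finite := by
  have h : {v : HeightOneSpectrum (𝓞 K) | ∃ ℓ ∈ S₀, ((ℓ : ℕ) : 𝓞 K) ∈ v.asIdeal} =
      ⋃ ℓ ∈ S₀, {v : HeightOneSpectrum (𝓞 K) | v.asIdeal ∣ Ideal.span {((ℓ : ℕ) : 𝓞 K)}} := by
    ext v
    simp [Ideal.dvd_span_singleton]
  rw [h]
  refine Set.Finite.biUnion S₀.finite_toSet fun ℓ hℓ => Ideal.finite_factors ?_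
  have hℓ0 : ℓ ≠ 0 := fun h => h0 (h ▸ hℓ)
  rw [Ne, Ideal.zero_eq_bot, Ideal.span_singleton_eq_bot]
  exact_mod_cast hℓ0

/-- S3 (Chebotarev transfer): if at every good place the Frobenius polynomial of `σ` is that of `r` or its
`X ↦ -X` flip, then `det r = det σ` and `tr r = ± tr σ` everywhere on `Γ_K` (Frobenii at the good places are
dense, `absoluteGaloisGroup.frobenius_dense`; the condition is closed). -/
theorem stub_frobeniusSignTransfer :
    ∀ (K : Type) [Field K] [NumberField K] (p : ℕ) [Fact p.Prime]
      (σ r : FramedGaloisRep K (PadicAlgCl p) 2) (S₀ : Finset ℕ), (0 : ℕ) ∉ S₀ →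
      (∀ v : HeightOneSpectrum (𝓞 K), (∀ ℓ ∈ S₀, ((ℓ : ℕ) : 𝓞 K) ∉ v.asIdeal) →
        ∃ P : (PadicAlgCl p)[X], r.HasFrobCharpolyAt v P ∧
          (σ.HasFrobCharpolyAt v P ∨ σ.HasFrobCharpolyAt v (P.comp (-X)))) →
      ∀ g : absoluteGaloisGroup K,
        Matrix.det ((r g : GL (Fin 2) (PadicAlgCl p)) : Matrix (Fin 2) (Fin 2) (PadicAlgCl p)) =
          Matrix.det ((σ g : GL (Fin 2) (PadicAlgCl p)) : Matrix (Fin 2) (Fin 2) (PadicAlgCl p)) ∧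
        (Matrix.trace ((r g : GL (Fin 2) (PadicAlgCl p)) : Matrix (Fin 2) (Fin 2) (PadicAlgCl p)) =
            Matrix.trace ((σ g : GL (Fin 2) (PadicAlgCl p)) : Matrix (Fin 2) (Fin 2) (PadicAlgCl p)) ∨
         Matrix.trace ((r g : GL (Fin 2) (PadicAlgCl p)) : Matrix (Fin 2) (Fin 2) (PadicAlgCl p)) =
            -Matrix.trace ((σ g : GL (Fin 2) (PadicAlgCl p)) : Matrix (Fin 2) (Fin 2) (PadicAlgCl p))) := by
  intro K _ _ p _ σ r S₀ h0 hfrob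
  classical
  -- the two matrix-valued maps and their continuity
  set fr : absoluteGaloisGroup K → Matrix (Fin 2) (Fin 2) (PadicAlgCl p) :=
    fun g => ((r g : GL (Fin 2) (PadicAlgCl p)) : Matrix (Fin 2) (Fin 2) (PadicAlgCl p)) with hfr_def
  set fσ : absoluteGaloisGroup K → Matrix (Fin 2) (Fin 2) (PadicAlgCl p) :=
    fun g => ((σ g : GL (Fin 2) (PadicAlgCl p)) : Matrix (Fin 2) (Fin 2) (PadicAlgCl p)) with hfσ_def
  have hfr : Continuous fr := Units.continuous_val.comp (map_continuous r)
  have hfσ : Continuous fσ := Units.continuous_val.comp (map_continuous σ)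
  -- the condition set `C` is closed
  set C : Set (absoluteGaloisGroup K) :=
    {g | (fr g).det = (fσ g).det ∧ ((fr g).trace = (fσ g).trace ∨ (fr g).trace = -(fσ g).trace)}
    with hC_def
  have hC : IsClosed C :=
    (isClosed_eq hfr.matrix_det hfσ.matrix_det).inter
      ((isClosed_eq hfr.matrix_trace hfσ.matrix_trace).union
        (isClosed_eq hfr.matrix_trace hfσ.matrix_trace.neg))
  -- the finite bad set `S` and the dense set `D` of good Frobenii
  set S : Set (HeightOneSpectrum (𝓞 K)) := {v | ∃ ℓ ∈ S₀, ((ℓ : ℕ) : 𝓞 K) ∈ v.asIdeal}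
    with hS_def
  have hS : S.Finite := finite_setOf_exists_natCast_mem_asIdeal K S₀ h0
  set D : Set (absoluteGaloisGroup K) :=
    {φ | ∃ v ∉ S, ∃ 𝔓 ∈ v.primesAbove, IsArithFrobAt (𝓞 K) φ 𝔓} with hD_def
  have hD : Dense D := absoluteGaloisGroup.frobenius_dense chebotarev_artinRep_holds K S hS
  -- `D ⊆ C`: at a good Frobenius the characteristic polynomials agree up to the flip
  have hDC : D ⊆ C := by
    rintro φ ⟨v, hvS, 𝔓, h𝔓, hφ⟩
    have hv : ∀ ℓ ∈ S₀, ((ℓ : ℕ) : 𝓞 K) ∉ v.asIdeal := fun ℓ hℓ hmem => hvS ⟨ℓ, hℓ, hmem⟩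
    obtain ⟨P, hrP, hσP⟩ := hfrob v hv
    have h1 : (fr φ).charpoly = P := hrP 𝔓 h𝔓 φ hφ
    have h2 : (fσ φ).charpoly = P ∨ (fσ φ).charpoly = P.comp (-X) :=
      hσP.imp (fun h => h 𝔓 h𝔓 φ hφ) (fun h => h 𝔓 h𝔓 φ hφ)
    exact det_trace_of_charpoly_eq_or_comp_neg_X (R := PadicAlgCl p) h1 h2
  -- hence `C = Γ_K`
  have hCuniv : C = Set.univ := by
    rw [← hC.closure_eq]
    exact (hD.mono hDC).closure_eq
  intro g
  have hg : g ∈ C := by rw [hCuniv]; exact Set.mem_univ g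
  exact hg

end Summit.Langlands.Langlands.Theorems.ArtinWeightRealisationEven
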